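/-
b2b-lace packet, TAIL-BOUND ANALYST gen 11 (unit `b2b-lace-tail-g11`).  (S2b)-IMPR TABLE-SIDE KIT (T6): the D80 shift sums
`S_F(x) = Σ_ι (F(x+2e_ι) + F(x−2e_ι))` EXACTLY at the near nodes `2e₁`, `e₁+e₂` (and `e₁`) of the `f₃` cells, for any `W_d`-invariant
table `F` (in particular `S_{p,l} = S_{I_{p,l}}`), their monotone relaxations to the standard node list, and the read forms of the true
`IM` entries at the two near nodes.  `d`-generic; additive; no numeral of any dimension; everything proved.
-/
import Literature.Probability.FitznerVanDerHofstad2017.F3BoundsCellSplit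
import HarnessLib

/-!
# The shift sums `S_{p,l}` at the near nodes `2e₁`, `e₁ + e₂`, `e₁`

CITATION HEADER (PLACEMENT v2). Part of a certified REPRODUCTION of R. Fitzner, R. van der Hofstad, *Generalized approach to the
non-backtracking lace expansion*, PTRF **169** (2017) 1041–1119 [NoBLE17], (3.30) p. 1070 (the split of `sup_x Σ_y 2dD(y) G_z(y) G(x−y)`
producing the shifted points `x ± 2e_ι`, cf. `NobleF3InitialPoint` D80) with (3.35)–(3.38) p. 1071 (the SRW integrals are functions of the
symmetrised `D̂^{(x)}`, hence `W_d`-invariant) and Lemma 5.1 p. 1093 (monotonicity in each `|x_μ|`), and of R. Fitzner, R. van der Hofstad,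
*Mean-field behavior for nearest-neighbor percolation in `d > 10`*, EJP **22** (2017) no. 43 [FvdH17], §2.5 with the notebook
`Percolation.nb` (the `f₃` cells are evaluated POINTWISE at the points `2e₁`, `e₁+e₂` of `𝒳`; cell 5 also at `e₁`).

> [NoBLE17] (3.30): "… `≤ sup_x Σ_ι (G_z(x+2e_ι) + G_z(x−2e_ι)) · …`"; (3.35): "`I_{n,l}(x) = ∫ … D̂^{(x)}(k) …`";
> Lemma 5.1: "… monotone decreasing in `|x_μ|` for every `μ`".

## What is here (all proved, `d`-generic)

§1 Three-axis glue: `vecOfParts_triple_apply`, `vecOfParts_triple_eq_axisVec`, `axisVec_add3_eq_of_spInvariant`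
   (`F(a e_i + b e_j + c e_k)` is independent of the distinct triple of axes; private helpers `exists_perm_triple`,
   `abs_axisVec_add_axisVec`, `abs_axisVec_add3`) and the sign-normalisations `axisVec_add_axisVec_abs_eq_of_spInvariant`, `axisVec_add3_abs_eq_of_spInvariant`.
§2 EXACT shift sums of a `W_d`-invariant `F`: `shift2Sum_axisVec` (at `a e_κ`), `shift2Sum_axisVec_add_axisVec` (at `a e_i + b e_j`), and
   **`shift2Sum_vecOfParts_two : S_F(2e₁) = F(0) + F(4e₁) + (2d−2) F(2e₁+2e₂)`**,
   **`shift2Sum_classVec_two : S_F(e₁+e₂) = 2F(3e₁+e₂) + 2F(e₁+e₂) + (2d−4) F(2e₁+e₂+e₃)`**,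
   **`shift2Sum_vecOfParts_one : S_F(e₁) = F(3e₁) + F(e₁) + (2d−2) F(2e₁+e₂)`**.
§3 The same for `S_{p,l}` (`srwIShift2_vecOfParts_two / _classVec_two / _vecOfParts_one`), the monotone relaxations
   `srwI (3e₁+e₂) ≤ srwI (2e₁+e₂)`, `srwI (2e₁+e₂+e₃) ≤ srwI (1^3)` (`srwIShift2_classVec_two_le`), and READ FORMS with literal slots
   (`srwIShift2_vecOfParts_two_le_of`, `srwIShift2_classVec_two_le_of`, `srwIShift2_classVec_two_le_of_nodes`, `srwIShift2_vecOfParts_one_le_of`).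
§4 (namespace `F3Bounds`) READ FORMS of the true `IM` entries AT the near nodes: `srwTrue_IM_natCast_le_at_two / _at_oneOne`,
   `srwTrue_IM_negOne_le_at_two / _at_oneOne` — the `IM` hypotheses of `F3BoundsCellSplit.boundHD75_srwTrue_zero_at_le / _one_at_le` at
   `y = vecOfParts d [2]` and `y = classVec d 2 0` from `𝒥`, `I` node values and ONE literal inequality each.

## What is NOT here
No dimension, no table, no numeric value, no certificate; no statement about `d ≠` anything.
-/

noncomputable section

namespace Literature.Probability.FitznerVanDerHofstad2017

open Finset Real
open Literature.Barriers.CriticalPhenomena Literature.Probability.LatticeModels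

variable {d : ℕ}

/-! ### §1  Three-axis glue -/

/-- Values of `vecOfParts d [a, b, c]`. [cite: FitznerVanDerHofstad2016NoBLE, §5.1 p. 1093 (the nodes `3e₁, 2e₁+e₂, e₁+e₂+e₃`)] -/
theorem vecOfParts_triple_apply (a b c : ℕ) (μ : Fin d) :
    vecOfParts d [a, b, c] μ =
      if (μ : ℕ) = 0 then (a : ℤ) else if (μ : ℕ) = 1 then (b : ℤ) else if (μ : ℕ) = 2 then (c : ℤ) else 0 := by
  simp only [vecOfParts]
  split_ifs with h h' h''
  · simp [h]
  · simp [h']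
  · simp [h'']
  · obtain ⟨k, hk⟩ : ∃ k, (μ : ℕ) = k + 3 := ⟨(μ : ℕ) - 3, by omega⟩
    simp [hk]

/-- The node `a e₁ + b e₂ + c e₃` in the `vecOfParts` vocabulary. [cite: FitznerVanDerHofstad2016NoBLE, §5.1 p. 1093] -/
theorem vecOfParts_triple_eq_axisVec (hd : 3 ≤ d) (a b c : ℕ) :
    vecOfParts d [a, b, c] =
      axisVec ⟨0, by omega⟩ (a : ℤ) + axisVec ⟨1, by omega⟩ (b : ℤ) + axisVec ⟨2, by omega⟩ (c : ℤ) := by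
  funext μ
  rw [vecOfParts_triple_apply, Pi.add_apply, Pi.add_apply, axisVec_apply', axisVec_apply', axisVec_apply']
  simp only [Fin.ext_iff]
  by_cases h0 : (μ : ℕ) = 0
  · simp [h0]
  · by_cases h1 : (μ : ℕ) = 1
    · simp [h1]
    · by_cases h2 : (μ : ℕ) = 2
      · simp [h2]
      · simp [h0, h1, h2]

/-- `1^3 = e₁ + e₂ + e₃` in the `vecOfParts` vocabulary. [cite: FitznerVanDerHofstad2016NoBLE, §5.1 p. 1093] -/
theorem classVec_three_zero_eq_vecOfParts : classVec d 3 0 = vecOfParts d [1, 1, 1] := by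
  funext μ
  rw [classVec_zero_right_apply, vecOfParts_triple_apply]
  push_cast
  split_ifs <;> first | rfl | omega

/-- Two ordered triples of distinct axes are exchanged by a permutation. [folklore] -/
private theorem exists_perm_triple {i j k i' j' k' : Fin d} (hij : i ≠ j) (hik : i ≠ k) (hjk : j ≠ k)
    (hij' : i' ≠ j') (hik' : i' ≠ k') (hjk' : j' ≠ k') :
    ∃ ν : Equiv.Perm (Fin d), ν i' = i ∧ ν j' = j ∧ ν k' = k := by
  obtain ⟨ν₁, h1, h2⟩ := exists_perm_pair hij hij'
  have hk1 : ν₁ k' ≠ i := fun h => hik' (ν₁.injective (h.trans h1.symm)).symm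
  have hk2 : ν₁ k' ≠ j := fun h => hjk' (ν₁.injective (h.trans h2.symm)).symm
  refine ⟨Equiv.swap (ν₁ k') k * ν₁, ?_, ?_, ?_⟩
  · rw [Equiv.Perm.mul_apply, h1, Equiv.swap_apply_of_ne_of_ne hk1.symm hik]
  · rw [Equiv.Perm.mul_apply, h2, Equiv.swap_apply_of_ne_of_ne hk2.symm hjk]
  · rw [Equiv.Perm.mul_apply, Equiv.swap_apply_left]

/-- `F (a e_i + b e_j + c e_k)` (`i, j, k` distinct) does not depend on the ordered triple of distinct axes.
[cite: FitznerVanDerHofstad2016NoBLE, (3.35) p. 1071] -/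
theorem axisVec_add3_eq_of_spInvariant {F : (Fin d → ℤ) → ℝ} (hI : SpInvariant F) {i j k i' j' k' : Fin d}
    (hij : i ≠ j) (hik : i ≠ k) (hjk : j ≠ k) (hij' : i' ≠ j') (hik' : i' ≠ k') (hjk' : j' ≠ k') (a b c : ℤ) :
    F (axisVec i a + axisVec j b + axisVec k c) = F (axisVec i' a + axisVec j' b + axisVec k' c) := by
  obtain ⟨ν, hνi, hνj, hνk⟩ := exists_perm_triple hij hik hjk hij' hik' hjk'
  have key : spAct (ν, fun _ => (1 : ℤˣ)) (axisVec i a + axisVec j b + axisVec k c) =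
      axisVec i' a + axisVec j' b + axisVec k' c := by
    funext μ
    rw [spAct_perm_one_apply, Pi.add_apply, Pi.add_apply, Pi.add_apply, Pi.add_apply, axisVec_apply', axisVec_apply',
      axisVec_apply', axisVec_apply', axisVec_apply', axisVec_apply', ← hνi, ← hνj, ← hνk]
    simp only [EmbeddingLike.apply_eq_iff_eq]
  rw [← key, hI]

/-- `|a e_i + b e_j| = |a| e_i + |b| e_j` coordinatewise (`i ≠ j`). [folklore] -/
private theorem abs_axisVec_add_axisVec {i j : Fin d} (hij : i ≠ j) (a b : ℤ) :
    (fun μ => |(axisVec i a + axisVec j b) μ|) = axisVec i |a| + axisVec j |b| := by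
  funext μ
  simp only [Pi.add_apply, axisVec_apply']
  by_cases hμi : μ = i
  · subst hμi; simp [hij]
  · by_cases hμj : μ = j
    · subst hμj; simp [hμi]
    · simp [hμi, hμj]

/-- `|a e_i + b e_j + c e_k| = |a| e_i + |b| e_j + |c| e_k` coordinatewise (`i, j, k` distinct). [folklore] -/
private theorem abs_axisVec_add3 {i j k : Fin d} (hij : i ≠ j) (hik : i ≠ k) (hjk : j ≠ k) (a b c : ℤ) :
    (fun μ => |(axisVec i a + axisVec j b + axisVec k c) μ|) = axisVec i |a| + axisVec j |b| + axisVec k |c| := by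
  funext μ
  simp only [Pi.add_apply, axisVec_apply']
  by_cases hμi : μ = i
  · subst hμi; simp [hij, hik]
  · by_cases hμj : μ = j
    · subst hμj; simp [hμi, hjk]
    · by_cases hμk : μ = k
      · subst hμk; simp [hμi, hμj]
      · simp [hμi, hμj, hμk]

/-- Sign normalisation at a two-axis point: `F (a e_i + b e_j) = F (|a| e_i + |b| e_j)`. [cite: FitznerVanDerHofstad2016NoBLE, (3.35) p. 1071] -/
theorem axisVec_add_axisVec_abs_eq_of_spInvariant {F : (Fin d → ℤ) → ℝ} (hI : SpInvariant F) {i j : Fin d} (hij : i ≠ j)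
    (a b : ℤ) : F (axisVec i a + axisVec j b) = F (axisVec i |a| + axisVec j |b|) := by
  rw [eq_abs_of_spInvariant hI (axisVec i a + axisVec j b), abs_axisVec_add_axisVec hij]

/-- Sign normalisation at a three-axis point. [cite: FitznerVanDerHofstad2016NoBLE, (3.35) p. 1071] -/
theorem axisVec_add3_abs_eq_of_spInvariant {F : (Fin d → ℤ) → ℝ} (hI : SpInvariant F) {i j k : Fin d} (hij : i ≠ j)
    (hik : i ≠ k) (hjk : j ≠ k) (a b c : ℤ) :
    F (axisVec i a + axisVec j b + axisVec k c) = F (axisVec i |a| + axisVec j |b| + axisVec k |c|) := by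
  rw [eq_abs_of_spInvariant hI (axisVec i a + axisVec j b + axisVec k c), abs_axisVec_add3 hij hik hjk]

/-- Sum of a constant plus two (different) bumps over `Fin d`. [folklore] -/
private theorem sum_const_add_ite_add_ite' (i j : Fin d) (b e₁ e₂ : ℝ) :
    ∑ ι : Fin d, (b + (if ι = i then e₁ else 0) + (if ι = j then e₂ else 0)) = d * b + e₁ + e₂ := by
  rw [Finset.sum_add_distrib, sum_const_add_ite, Finset.sum_ite_eq' Finset.univ j (fun _ => e₂),
    if_pos (Finset.mem_univ _)]

/-! ### §2  Exact shift sums of a `W_d`-invariant table -/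

/-- **`S_F` at an axis point `a e_κ`** (`d ≥ 2`): `S_F(a e_κ) = F((a+2) e_κ) + F((a−2) e_κ) + (2d−2) F(|a| e₁ + 2 e₂)`.
[cite: FitznerVanDerHofstad2016NoBLE, (3.30) p. 1070; (3.35) p. 1071] -/
theorem shift2Sum_axisVec {F : (Fin d → ℤ) → ℝ} (hI : SpInvariant F) (hd : 2 ≤ d) (κ : Fin d) (a : ℤ) :
    shift2Sum F (axisVec κ a) = F (axisVec κ (a + 2)) + F (axisVec κ (a - 2))
      + (2 * d - 2) * F (axisVec (⟨0, by omega⟩ : Fin d) |a| + axisVec (⟨1, by omega⟩ : Fin d) 2) := by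
  set i₀ : Fin d := ⟨0, by omega⟩ with hi₀
  set i₁ : Fin d := ⟨1, by omega⟩ with hi₁
  have h01 : i₀ ≠ i₁ := by simp [hi₀, hi₁, Fin.ext_iff]
  set g := F (axisVec i₀ |a| + axisVec i₁ 2) with hg
  have hoff : ∀ ι : Fin d, ι ≠ κ → ∀ s : ℤ, |s| = 2 → F (axisVec κ a + axisVec ι s) = g := by
    intro ι hικ s hs
    rw [axisVec_add_axisVec_abs_eq_of_spInvariant hI (Ne.symm hικ), hs]
    exact axisVec_add_axisVec_eq_of_spInvariant hI (Ne.symm hικ) h01 |a| 2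
  have hterm : ∀ ι : Fin d, F (axisVec κ a + axisVec ι 2) + F (axisVec κ a - axisVec ι 2) =
      2 * g + (if ι = κ then F (axisVec κ (a + 2)) + F (axisVec κ (a - 2)) - 2 * g else 0) := by
    intro ι
    by_cases hικ : ι = κ
    · rw [hικ, if_pos rfl, sub_axisVec_eq_add, axisVec_add_axisVec_same, axisVec_add_axisVec_same, ← sub_eq_add_neg]
      ring
    · rw [if_neg hικ, add_zero, sub_axisVec_eq_add, hoff ι hικ 2 (by norm_num), hoff ι hικ (-2) (by norm_num)]
      ring
  unfold shift2Sum
  rw [Finset.sum_congr rfl fun ι _ => hterm ι, sum_const_add_ite]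
  ring

/-- **`S_F` at a two-axis point `a e_i + b e_j`** (`i ≠ j`, `d ≥ 3`): the four shifts along `i`, `j` and `2d−4` copies of
`F(|a| e₁ + |b| e₂ + 2 e₃)`. [cite: FitznerVanDerHofstad2016NoBLE, (3.30) p. 1070; (3.35) p. 1071] -/
theorem shift2Sum_axisVec_add_axisVec {F : (Fin d → ℤ) → ℝ} (hI : SpInvariant F) (hd : 3 ≤ d) {i j : Fin d} (hij : i ≠ j)
    (a b : ℤ) :
    shift2Sum F (axisVec i a + axisVec j b) =
      F (axisVec i (a + 2) + axisVec j b) + F (axisVec i (a - 2) + axisVec j b)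
      + (F (axisVec i a + axisVec j (b + 2)) + F (axisVec i a + axisVec j (b - 2)))
      + (2 * d - 4) * F (axisVec (⟨0, by omega⟩ : Fin d) |a| + axisVec (⟨1, by omega⟩ : Fin d) |b|
          + axisVec (⟨2, by omega⟩ : Fin d) 2) := by
  set i₀ : Fin d := ⟨0, by omega⟩ with hi₀
  set i₁ : Fin d := ⟨1, by omega⟩ with hi₁
  set i₂ : Fin d := ⟨2, by omega⟩ with hi₂
  have h01 : i₀ ≠ i₁ := by simp [hi₀, hi₁, Fin.ext_iff]
  have h02 : i₀ ≠ i₂ := by simp [hi₀, hi₂, Fin.ext_iff]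
  have h12 : i₁ ≠ i₂ := by simp [hi₁, hi₂, Fin.ext_iff]
  set g := F (axisVec i₀ |a| + axisVec i₁ |b| + axisVec i₂ 2) with hg
  have hoff : ∀ ι : Fin d, ι ≠ i → ι ≠ j → ∀ s : ℤ, |s| = 2 → F (axisVec i a + axisVec j b + axisVec ι s) = g := by
    intro ι hιi hιj s hs
    rw [axisVec_add3_abs_eq_of_spInvariant hI hij (Ne.symm hιi) (Ne.symm hιj), hs]
    exact axisVec_add3_eq_of_spInvariant hI hij (Ne.symm hιi) (Ne.symm hιj) h01 h02 h12 |a| |b| 2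
  have hterm : ∀ ι : Fin d, F (axisVec i a + axisVec j b + axisVec ι 2) + F (axisVec i a + axisVec j b - axisVec ι 2) =
      2 * g + (if ι = i then F (axisVec i (a + 2) + axisVec j b) + F (axisVec i (a - 2) + axisVec j b) - 2 * g else 0)
        + (if ι = j then F (axisVec i a + axisVec j (b + 2)) + F (axisVec i a + axisVec j (b - 2)) - 2 * g else 0) := by
    intro ι
    by_cases hιi : ι = i
    · rw [hιi, if_pos rfl, if_neg hij, add_zero, sub_axisVec_eq_add, add_right_comm _ (axisVec j b) (axisVec i 2),
        add_right_comm _ (axisVec j b) (axisVec i (-2)), axisVec_add_axisVec_same, axisVec_add_axisVec_same,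
        ← sub_eq_add_neg]
      ring
    · by_cases hιj : ι = j
      · rw [hιj, if_neg (Ne.symm hij), if_pos rfl, add_zero, sub_axisVec_eq_add, add_assoc _ (axisVec j b) (axisVec j 2),
          add_assoc _ (axisVec j b) (axisVec j (-2)), axisVec_add_axisVec_same, axisVec_add_axisVec_same, ← sub_eq_add_neg]
        ring
      · rw [if_neg hιi, if_neg hιj, add_zero, add_zero, sub_axisVec_eq_add, hoff ι hιi hιj 2 (by norm_num),
          hoff ι hιi hιj (-2) (by norm_num)]
        ring
  unfold shift2Sum
  rw [Finset.sum_congr rfl fun ι _ => hterm ι, sum_const_add_ite_add_ite']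
  ring

/-- **`S_F(2e₁) = F(0) + F(4e₁) + (2d−2)·F(2e₁+2e₂)`** (`d ≥ 2`).
[cite: FitznerVanDerHofstad2016NoBLE, (3.30) p. 1070; (3.35) p. 1071] [cite: FitznerVanDerHofstad2017, §2.5, notebook Percolation.nb (point `2e₁` of `𝒳`)] -/
theorem shift2Sum_vecOfParts_two {F : (Fin d → ℤ) → ℝ} (hI : SpInvariant F) (hd : 2 ≤ d) :
    shift2Sum F (vecOfParts d [2]) = F 0 + F (vecOfParts d [4]) + (2 * d - 2) * F (vecOfParts d [2, 2]) := by
  rw [vecOfParts_single_eq_axisVec (by omega : 1 ≤ d) 2, vecOfParts_single_eq_axisVec (by omega : 1 ≤ d) 4,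
    vecOfParts_pair_eq_axisVec hd 2 2]
  push_cast
  rw [shift2Sum_axisVec hI hd, show (2 : ℤ) + 2 = 4 by norm_num, show (2 : ℤ) - 2 = 0 by norm_num, axisVec_zero_right,
    show |(2 : ℤ)| = 2 by norm_num]
  ring

/-- **`S_F(e₁) = F(3e₁) + F(e₁) + (2d−2)·F(2e₁+e₂)`** (`d ≥ 2`).
[cite: FitznerVanDerHofstad2016NoBLE, (3.30) p. 1070; (3.35) p. 1071] [cite: FitznerVanDerHofstad2017, §2.5, notebook Percolation.nb (cell 5 at `e₁`)] -/
theorem shift2Sum_vecOfParts_one {F : (Fin d → ℤ) → ℝ} (hI : SpInvariant F) (hd : 2 ≤ d) :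
    shift2Sum F (vecOfParts d [1]) = F (vecOfParts d [3]) + F (vecOfParts d [1]) + (2 * d - 2) * F (vecOfParts d [2, 1]) := by
  have h01 : (⟨0, by omega⟩ : Fin d) ≠ ⟨1, by omega⟩ := by simp [Fin.ext_iff]
  rw [vecOfParts_single_eq_axisVec (by omega : 1 ≤ d) 1, vecOfParts_single_eq_axisVec (by omega : 1 ≤ d) 3,
    vecOfParts_pair_eq_axisVec hd 2 1]
  push_cast
  rw [shift2Sum_axisVec hI hd, show (1 : ℤ) + 2 = 3 by norm_num, show (1 : ℤ) - 2 = -1 by norm_num,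
    axisVec_neg_eq_of_spInvariant hI, show |(1 : ℤ)| = 1 by norm_num,
    axisVec_add_axisVec_eq_of_spInvariant hI h01 h01.symm 1 2, add_comm (axisVec _ (1 : ℤ)) (axisVec _ (2 : ℤ))]

/-- **`S_F(e₁+e₂) = 2·F(3e₁+e₂) + 2·F(e₁+e₂) + (2d−4)·F(2e₁+e₂+e₃)`** (`d ≥ 3`).
[cite: FitznerVanDerHofstad2016NoBLE, (3.30) p. 1070; (3.35) p. 1071] [cite: FitznerVanDerHofstad2017, §2.5, notebook Percolation.nb (point `e₁+e₂` of `𝒳`)] -/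
theorem shift2Sum_classVec_two {F : (Fin d → ℤ) → ℝ} (hI : SpInvariant F) (hd : 3 ≤ d) :
    shift2Sum F (classVec d 2 0) =
      2 * F (vecOfParts d [3, 1]) + 2 * F (classVec d 2 0) + (2 * d - 4) * F (vecOfParts d [2, 1, 1]) := by
  set i₀ : Fin d := ⟨0, by omega⟩ with hi₀
  set i₁ : Fin d := ⟨1, by omega⟩ with hi₁
  set i₂ : Fin d := ⟨2, by omega⟩ with hi₂
  have h01 : i₀ ≠ i₁ := by simp [hi₀, hi₁, Fin.ext_iff]
  have h02 : i₀ ≠ i₂ := by simp [hi₀, hi₂, Fin.ext_iff]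
  have h12 : i₁ ≠ i₂ := by simp [hi₁, hi₂, Fin.ext_iff]
  rw [classVec_two_zero_eq_axisVec (by omega : 2 ≤ d), vecOfParts_pair_eq_axisVec (by omega : 2 ≤ d) 3 1,
    vecOfParts_triple_eq_axisVec hd 2 1 1]
  push_cast
  rw [shift2Sum_axisVec_add_axisVec hI hd h01 1 1, show (1 : ℤ) + 2 = 3 by norm_num, show (1 : ℤ) - 2 = -1 by norm_num,
    show |(1 : ℤ)| = 1 by norm_num]
  have hA : F (axisVec i₀ (-1) + axisVec i₁ 1) = F (axisVec i₀ 1 + axisVec i₁ 1) := by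
    rw [axisVec_add_axisVec_abs_eq_of_spInvariant hI h01 (-1) 1]; norm_num
  have hB : F (axisVec i₀ 1 + axisVec i₁ 3) = F (axisVec i₀ 3 + axisVec i₁ 1) := by
    rw [axisVec_add_axisVec_eq_of_spInvariant hI h01 h01.symm 1 3, add_comm]
  have hC : F (axisVec i₀ 1 + axisVec i₁ (-1)) = F (axisVec i₀ 1 + axisVec i₁ 1) := by
    rw [axisVec_add_axisVec_abs_eq_of_spInvariant hI h01 1 (-1)]; norm_num
  have hD : F (axisVec i₀ 1 + axisVec i₁ 1 + axisVec i₂ 2) = F (axisVec i₀ 2 + axisVec i₁ 1 + axisVec i₂ 1) := by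
    rw [show axisVec i₀ 1 + axisVec i₁ 1 + axisVec i₂ 2 = axisVec i₂ 2 + axisVec i₀ 1 + axisVec i₁ 1 by
      rw [add_comm (axisVec i₀ 1 + axisVec i₁ 1), ← add_assoc]]
    exact axisVec_add3_eq_of_spInvariant hI h02.symm h12.symm h01 h01 h02 h12 2 1 1
  rw [hA, hB, hC, hD]
  ring

/-! ### §3  `S_{p,l}` at the near nodes, relaxations and read forms -/

/-- **`S_{p,l}(2e₁) = I(0) + I(4e₁) + (2d−2)·I(2e₁+2e₂)`**, `I = I_{p,l}` (`d ≥ 2`).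
[cite: FitznerVanDerHofstad2016NoBLE, (3.30) p. 1070; (3.35) p. 1071] [cite: FitznerVanDerHofstad2017, §2.5, notebook Percolation.nb] -/
theorem srwIShift2_vecOfParts_two (p l : ℕ) (hd : 2 ≤ d) :
    srwIShift2 d p l (vecOfParts d [2]) =
      srwI d p l 0 + srwI d p l (vecOfParts d [4]) + (2 * d - 2) * srwI d p l (vecOfParts d [2, 2]) := by
  rw [srwIShift2_eq_shift2Sum]
  exact shift2Sum_vecOfParts_two (spInvariant_srwI p l) hd

/-- **`S_{p,l}(e₁) = I(3e₁) + I(e₁) + (2d−2)·I(2e₁+e₂)`** (`d ≥ 2`).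
[cite: FitznerVanDerHofstad2016NoBLE, (3.30) p. 1070; (3.35) p. 1071] [cite: FitznerVanDerHofstad2017, §2.5, notebook Percolation.nb] -/
theorem srwIShift2_vecOfParts_one (p l : ℕ) (hd : 2 ≤ d) :
    srwIShift2 d p l (vecOfParts d [1]) =
      srwI d p l (vecOfParts d [3]) + srwI d p l (vecOfParts d [1]) + (2 * d - 2) * srwI d p l (vecOfParts d [2, 1]) := by
  rw [srwIShift2_eq_shift2Sum]
  exact shift2Sum_vecOfParts_one (spInvariant_srwI p l) hd

/-- **`S_{p,l}(e₁+e₂) = 2·I(3e₁+e₂) + 2·I(e₁+e₂) + (2d−4)·I(2e₁+e₂+e₃)`** (`d ≥ 3`).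
[cite: FitznerVanDerHofstad2016NoBLE, (3.30) p. 1070; (3.35) p. 1071] [cite: FitznerVanDerHofstad2017, §2.5, notebook Percolation.nb] -/
theorem srwIShift2_classVec_two (p l : ℕ) (hd : 3 ≤ d) :
    srwIShift2 d p l (classVec d 2 0) =
      2 * srwI d p l (vecOfParts d [3, 1]) + 2 * srwI d p l (classVec d 2 0)
        + (2 * d - 4) * srwI d p l (vecOfParts d [2, 1, 1]) := by
  rw [srwIShift2_eq_shift2Sum]
  exact shift2Sum_classVec_two (spInvariant_srwI p l) hd

/-- `I(3e₁+e₂) ≤ I(2e₁+e₂)` (`p ≥ 1`, `d ≥ 2p+1`). [cite: FitznerVanDerHofstad2016NoBLE, Lemma 5.1 p. 1093] -/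
theorem srwI_vecOfParts_three_one_le {p : ℕ} (hp : 1 ≤ p) (hd : 2 * p + 1 ≤ d) (l : ℕ) :
    srwI d p l (vecOfParts d [3, 1]) ≤ srwI d p l (vecOfParts d [2, 1]) :=
  absMonotone_srwI hp hd l _ _ fun μ => by
    rw [vecOfParts_pair_apply, vecOfParts_pair_apply]
    split_ifs <;> norm_num

/-- `I(2e₁+e₂+e₃) ≤ I(e₁+e₂+e₃) = I(1^3)` (`p ≥ 1`, `d ≥ 2p+1`). [cite: FitznerVanDerHofstad2016NoBLE, Lemma 5.1 p. 1093] -/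
theorem srwI_vecOfParts_two_one_one_le {p : ℕ} (hp : 1 ≤ p) (hd : 2 * p + 1 ≤ d) (l : ℕ) :
    srwI d p l (vecOfParts d [2, 1, 1]) ≤ srwI d p l (classVec d 3 0) :=
  absMonotone_srwI hp hd l _ _ fun μ => by
    rw [classVec_three_zero_eq_vecOfParts, vecOfParts_triple_apply, vecOfParts_triple_apply]
    split_ifs <;> norm_num

/-- **Relaxed node form at `e₁+e₂`**: `S_{p,l}(e₁+e₂) ≤ 2·I(2e₁+e₂) + 2·I(e₁+e₂) + (2d−4)·I(1^3)` (`p ≥ 1`, `d ≥ 2p+1`).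
[cite: FitznerVanDerHofstad2016NoBLE, (3.30) p. 1070; Lemma 5.1 p. 1093] -/
theorem srwIShift2_classVec_two_le {p : ℕ} (hp : 1 ≤ p) (hd : 2 * p + 1 ≤ d) (l : ℕ) :
    srwIShift2 d p l (classVec d 2 0) ≤
      2 * srwI d p l (vecOfParts d [2, 1]) + 2 * srwI d p l (classVec d 2 0)
        + (2 * d - 4) * srwI d p l (classVec d 3 0) := by
  rw [srwIShift2_classVec_two p l (by omega)]
  have h1 := srwI_vecOfParts_three_one_le hp hd l
  have h2 := srwI_vecOfParts_two_one_one_le hp hd l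
  have hd' : (3 : ℝ) ≤ d := by exact_mod_cast (show 3 ≤ d by omega)
  nlinarith

/-- READ FORM at `2e₁`: `S_{p,l}(2e₁) ≤ A + B + (2d−2)·C` from `I(0) ≤ A`, `I(4e₁) ≤ B`, `I(2e₁+2e₂) ≤ C` (`d ≥ 2`).
[cite: FitznerVanDerHofstad2016NoBLE, (3.30) p. 1070] [cite: FitznerVanDerHofstad2017, §2.5, notebook Percolation.nb] -/
theorem srwIShift2_vecOfParts_two_le_of (p l : ℕ) (hd : 2 ≤ d) {A B C : ℝ} (h0 : srwI d p l 0 ≤ A)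
    (h4 : srwI d p l (vecOfParts d [4]) ≤ B) (h22 : srwI d p l (vecOfParts d [2, 2]) ≤ C) :
    srwIShift2 d p l (vecOfParts d [2]) ≤ A + B + (2 * d - 2) * C := by
  rw [srwIShift2_vecOfParts_two p l hd]
  have hd' : (2 : ℝ) ≤ d := by exact_mod_cast hd
  nlinarith

/-- READ FORM at `e₁+e₂` (exact nodes): `S_{p,l}(e₁+e₂) ≤ 2A + 2B + (2d−4)·C` from `I(3e₁+e₂) ≤ A`, `I(e₁+e₂) ≤ B`, `I(2e₁+e₂+e₃) ≤ C`
(`d ≥ 3`). [cite: FitznerVanDerHofstad2016NoBLE, (3.30) p. 1070] [cite: FitznerVanDerHofstad2017, §2.5, notebook Percolation.nb] -/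
theorem srwIShift2_classVec_two_le_of (p l : ℕ) (hd : 3 ≤ d) {A B C : ℝ} (h31 : srwI d p l (vecOfParts d [3, 1]) ≤ A)
    (h11 : srwI d p l (classVec d 2 0) ≤ B) (h211 : srwI d p l (vecOfParts d [2, 1, 1]) ≤ C) :
    srwIShift2 d p l (classVec d 2 0) ≤ 2 * A + 2 * B + (2 * d - 4) * C := by
  rw [srwIShift2_classVec_two p l hd]
  have hd' : (3 : ℝ) ≤ d := by exact_mod_cast hd
  nlinarith

/-- READ FORM at `e₁+e₂` (relaxed nodes): `S_{p,l}(e₁+e₂) ≤ 2A + 2B + (2d−4)·C` from `I(2e₁+e₂) ≤ A`, `I(e₁+e₂) ≤ B`, `I(1^3) ≤ C`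
(`p ≥ 1`, `d ≥ 2p+1`). [cite: FitznerVanDerHofstad2016NoBLE, (3.30) p. 1070; Lemma 5.1 p. 1093] -/
theorem srwIShift2_classVec_two_le_of_nodes {p : ℕ} (hp : 1 ≤ p) (hd : 2 * p + 1 ≤ d) (l : ℕ) {A B C : ℝ}
    (h21 : srwI d p l (vecOfParts d [2, 1]) ≤ A) (h11 : srwI d p l (classVec d 2 0) ≤ B)
    (h111 : srwI d p l (classVec d 3 0) ≤ C) :
    srwIShift2 d p l (classVec d 2 0) ≤ 2 * A + 2 * B + (2 * d - 4) * C := by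
  refine (srwIShift2_classVec_two_le hp hd l).trans ?_
  have hd' : (3 : ℝ) ≤ d := by exact_mod_cast (show 3 ≤ d by omega)
  nlinarith

/-- READ FORM at `e₁`: `S_{p,l}(e₁) ≤ A + B + (2d−2)·C` from `I(3e₁) ≤ A`, `I(e₁) ≤ B`, `I(2e₁+e₂) ≤ C` (`d ≥ 2`).
[cite: FitznerVanDerHofstad2016NoBLE, (3.30) p. 1070] [cite: FitznerVanDerHofstad2017, §2.5, notebook Percolation.nb] -/
theorem srwIShift2_vecOfParts_one_le_of (p l : ℕ) (hd : 2 ≤ d) {A B C : ℝ} (h3 : srwI d p l (vecOfParts d [3]) ≤ A)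
    (h1 : srwI d p l (vecOfParts d [1]) ≤ B) (h21 : srwI d p l (vecOfParts d [2, 1]) ≤ C) :
    srwIShift2 d p l (vecOfParts d [1]) ≤ A + B + (2 * d - 2) * C := by
  rw [srwIShift2_vecOfParts_one p l hd]
  have hd' : (2 : ℝ) ≤ d := by exact_mod_cast hd
  nlinarith

namespace F3Bounds

variable {afmin afmax : ℝ}

/-! ### §4  The true `IM` entries at the near nodes (read forms) -/

/-- **`(srwTrue).IM m l (2e₁) ≤ t`** (`m ≥ 0`) from `𝒥_{m+2,l}(2e₁) ≤ t`, `I_{m+3,l}(2e₁) ≤ d·α̲·t`, the three node values of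
`I_{m+3,l}` at `0`, `4e₁`, `2e₁+2e₂`, and `(ᾱ−1)(A + B + (2d−2)C) ≤ 2d²·t`.
[cite: FitznerVanDerHofstad2016NoBLE, §3.3.5 (3.87) p. 1079; (3.30)] [cite: FitznerVanDerHofstad2017, §2.5, notebook Percolation.nb] -/
theorem srwTrue_IM_natCast_le_at_two (hd : 2 ≤ d) (hα : 0 < afmin) (hᾱ : 1 ≤ afmax) {m l : ℕ} {t A B C : ℝ}
    (hJ : srwJ d (m + 2) l (vecOfParts d [2]) ≤ t) (hI : srwI d (m + 3) l (vecOfParts d [2]) ≤ d * afmin * t)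
    (h0 : srwI d (m + 3) l 0 ≤ A) (h4 : srwI d (m + 3) l (vecOfParts d [4]) ≤ B)
    (h22 : srwI d (m + 3) l (vecOfParts d [2, 2]) ≤ C) (hnum : (afmax - 1) * (A + B + (2 * d - 2) * C) ≤ 2 * (d : ℝ) ^ 2 * t) :
    (srwTrue d afmin afmax).IM m l (vecOfParts d [2]) ≤ t :=
  srwTrue_IM_natCast_le (by omega) hα hJ hI
    ((mul_le_mul_of_nonneg_left (srwIShift2_vecOfParts_two_le_of (m + 3) l hd h0 h4 h22) (by linarith)).trans hnum)

/-- **`(srwTrue).IM m l (e₁+e₂) ≤ t`** (`m ≥ 0`, `d ≥ 2(m+3)+1`) from `𝒥_{m+2,l}(e₁+e₂) ≤ t`, `I_{m+3,l}(e₁+e₂) ≤ d·α̲·t`, the node values of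
`I_{m+3,l}` at `2e₁+e₂`, `e₁+e₂`, `1^3` (relaxed nodes), and `(ᾱ−1)(2A + 2B + (2d−4)C) ≤ 2d²·t`.
[cite: FitznerVanDerHofstad2016NoBLE, §3.3.5 (3.87) p. 1079; (3.30); Lemma 5.1] [cite: FitznerVanDerHofstad2017, §2.5, notebook Percolation.nb] -/
theorem srwTrue_IM_natCast_le_at_oneOne (hα : 0 < afmin) (hᾱ : 1 ≤ afmax) {m l : ℕ} (hd : 2 * (m + 3) + 1 ≤ d) {t A B C : ℝ}
    (hJ : srwJ d (m + 2) l (classVec d 2 0) ≤ t) (hI : srwI d (m + 3) l (classVec d 2 0) ≤ d * afmin * t)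
    (h21 : srwI d (m + 3) l (vecOfParts d [2, 1]) ≤ A) (h11 : srwI d (m + 3) l (classVec d 2 0) ≤ B)
    (h111 : srwI d (m + 3) l (classVec d 3 0) ≤ C) (hnum : (afmax - 1) * (2 * A + 2 * B + (2 * d - 4) * C) ≤ 2 * (d : ℝ) ^ 2 * t) :
    (srwTrue d afmin afmax).IM m l (classVec d 2 0) ≤ t :=
  srwTrue_IM_natCast_le (by omega) hα hJ hI
    ((mul_le_mul_of_nonneg_left (srwIShift2_classVec_two_le_of_nodes (by omega) hd l h21 h11 h111) (by linarith)).trans hnum)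

/-- **`(srwTrue).IM (−1) l (2e₁) ≤ t`** from `I_{1,l+1}(2e₁) ≤ A₁`, the node values of `I_{2,l}` at `0`, `4e₁`, `2e₁+2e₂`,
`A₁ + (A + B + (2d−2)C)/(2d²α̲) ≤ t` and `I_{2,l}(2e₁) ≤ d·α̲·t` (`d ≥ 2`).
[cite: FitznerVanDerHofstad2016NoBLE, §3.3.5 (3.84)–(3.87) p. 1079; (3.30)] [cite: FitznerVanDerHofstad2017, §2.5, notebook Percolation.nb] -/
theorem srwTrue_IM_negOne_le_at_two (hd : 2 ≤ d) (hα : 0 < afmin) {l : ℕ} {t A₁ A B C : ℝ}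
    (hI1 : srwI d 1 (l + 1) (vecOfParts d [2]) ≤ A₁) (h0 : srwI d 2 l 0 ≤ A) (h4 : srwI d 2 l (vecOfParts d [4]) ≤ B)
    (h22 : srwI d 2 l (vecOfParts d [2, 2]) ≤ C) (hnum : A₁ + (A + B + (2 * d - 2) * C) / (2 * (d : ℝ) ^ 2 * afmin) ≤ t)
    (h2 : srwI d 2 l (vecOfParts d [2]) ≤ d * afmin * t) :
    (srwTrue d afmin afmax).IM (-1) l (vecOfParts d [2]) ≤ t := by
  refine srwTrue_IM_negOne_le (by omega) hα (le_trans ?_ hnum) h2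
  have hS := srwIShift2_vecOfParts_two_le_of 2 l hd h0 h4 h22
  have hc : 0 ≤ 2 * (d : ℝ) ^ 2 * afmin := mul_nonneg (mul_nonneg (by norm_num) (sq_nonneg _)) hα.le
  exact add_le_add hI1 (div_le_div_of_nonneg_right hS hc)

/-- **`(srwTrue).IM (−1) l (e₁+e₂) ≤ t`** from `I_{1,l+1}(e₁+e₂) ≤ A₁`, the node values of `I_{2,l}` at `2e₁+e₂`, `e₁+e₂`, `1^3`
(relaxed nodes), `A₁ + (2A + 2B + (2d−4)C)/(2d²α̲) ≤ t` and `I_{2,l}(e₁+e₂) ≤ d·α̲·t` (`d ≥ 5`).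
[cite: FitznerVanDerHofstad2016NoBLE, §3.3.5 (3.84)–(3.87) p. 1079; (3.30); Lemma 5.1] [cite: FitznerVanDerHofstad2017, §2.5, notebook Percolation.nb] -/
theorem srwTrue_IM_negOne_le_at_oneOne (hd : 5 ≤ d) (hα : 0 < afmin) {l : ℕ} {t A₁ A B C : ℝ}
    (hI1 : srwI d 1 (l + 1) (classVec d 2 0) ≤ A₁) (h21 : srwI d 2 l (vecOfParts d [2, 1]) ≤ A)
    (h11 : srwI d 2 l (classVec d 2 0) ≤ B) (h111 : srwI d 2 l (classVec d 3 0) ≤ C)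
    (hnum : A₁ + (2 * A + 2 * B + (2 * d - 4) * C) / (2 * (d : ℝ) ^ 2 * afmin) ≤ t)
    (h2 : srwI d 2 l (classVec d 2 0) ≤ d * afmin * t) :
    (srwTrue d afmin afmax).IM (-1) l (classVec d 2 0) ≤ t := by
  refine srwTrue_IM_negOne_le (by omega) hα (le_trans ?_ hnum) h2
  have hS := srwIShift2_classVec_two_le_of_nodes (p := 2) (by norm_num) (by omega) l h21 h11 h111
  have hc : 0 ≤ 2 * (d : ℝ) ^ 2 * afmin := mul_nonneg (mul_nonneg (by norm_num) (sq_nonneg _)) hα.le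
  exact add_le_add hI1 (div_le_div_of_nonneg_right hS hc)

end F3Bounds

end Literature.Probability.FitznerVanDerHofstad2017

end
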